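import Literature.MathematicalPhysics.QuantumLattice.HartreeFockBlochTorus
import Literature.MathematicalPhysics.QuantumLattice.HubbardTorusPlaquetteDressedBound
import HarnessLib

/-!
# Ventures/CertifiedManyBodySolver — Upper/BlochPlaquetteCells.lean

HONEST FRAMING: first certified bounds; not a superconductivity verdict; every number certified or labelled float.

PLAQUETTES INSIDE MAGNETIC CELLS (sr-mbsolver L3 engine seat E1; step D3a of the Lean route for the plaquette-dressed
translation-invariant quasi-free uppers, eng-1/LEAN-GLUE-QF.md §4; theorem-only, nothing is claimed). The torus `(ℤ/2m)²` is tiled by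
the plaquettes `cellSite c a = 2c + a` of `PlaquetteLUC` AND cut into the magnetic cells of `HartreeFockBlochTorus` (`k i` cells of
`M i` sites in direction `i`, `k i · M i = 2m`); when the cell sides are even, `M i = 2 q i`, every plaquette lies in one cell:
* `val_cellIndex_cellSite`, `val_cellPos_cellSite` — the cell of the site `2c + a` is `c / q` and its position is `a + 2 (c mod q)`
  (coordinatewise); `cellIndex_cellSite_eq` (all four sites of a plaquette lie in the same cell);
* `cellIndex_cellSite_shiftCell` — the cell of the neighbouring plaquette `c + e_j` is the same cell if `c_j mod q_j + 1 < q_j` and the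
  next cell `+ e_j` otherwise; `mod_shiftCell` — its offset is `(c_j + 1) mod q_j`;
* `blochMatrix_cellSite_cellSite` — hence an entry of a Bloch matrix between two sites of the plaquettes `c`, `c + e_j` is the
  HARMONIC `|k|⁻¹ Σ_κ χ_κ(v̄) G κ (p, p')` with `v ∈ {0, ± e_j}` and positions `p, p'` determined by the offset `c mod q` alone;
* `sum_plaquette_eq_card_mul_sum_offset` — a function of the plaquette index that depends only on the offset `c mod q` sums to
  `|k| ·` (its sum over the offsets `r < q`).
These are the cell-periodicity facts that reduce the plaquette-dressed Slater functional of a Bloch reference on the torus to `|k|`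
copies of a cell expression (`Upper/BlochDressedPeriodic.lean`). Sources: Bach–Lieb–Solovej 1994 eq. (3a.2) (periodic Hartree–Fock
states) [BachLiebSolovej1994]. Everything is proved; no definition.
-/

noncomputable section

namespace Summit.Ventures.CertifiedManyBodySolver.Upper

open Matrix Finset
open Literature.MathematicalPhysics.QuantumLattice Literature.MathematicalPhysics.QuantumLattice.HartreeFock HeisenbergTL HubbardWave0
  PlaquetteLUC
open scoped ComplexConjugate

section CellArith

variable {m : ℕ} [NeZero m] {k M : Fin 2 → ℕ} [∀ i, NeZero (k i)] [∀ i, NeZero (M i)]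

/-- The value of the cell coordinate of a torus site: `(cellIndex x)_i = x_i / M_i`. [folklore] -/
theorem val_cellIndex {L : ℕ} [NeZero L] (hkM : ∀ i, k i * M i = L) (x : FermionTorus 2 L) (i : Fin 2) :
    (cellIndex hkM x i).val = (ofLex x i : ℕ) / M i := by
  unfold cellIndex
  rw [boxBlockDecomp_apply_fst, zmodBlock_val]
  unfold boxCast
  rw [ZMod.ringEquivCongr_val, FermionTorus.toTorusSite_apply, ZMod.val_natCast, Nat.mod_eq_of_lt (Fin.isLt _)]

/-- The value of the in-cell position of a torus site: `(cellPos x)_i = x_i mod M_i`. [folklore] -/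
theorem val_cellPos {L : ℕ} [NeZero L] (hkM : ∀ i, k i * M i = L) (x : FermionTorus 2 L) (i : Fin 2) :
    (cellPos hkM x i).val = (ofLex x i : ℕ) % M i := by
  unfold cellPos
  rw [boxBlockDecomp_apply_snd, zmodPos_val]
  unfold boxCast
  rw [ZMod.ringEquivCongr_val, FermionTorus.toTorusSite_apply, ZMod.val_natCast, Nat.mod_eq_of_lt (Fin.isLt _)]

variable {q : Fin 2 → ℕ}

omit [NeZero m] [∀ i, NeZero (k i)] in
/-- With even cell sides `M i = 2 q i`: `q i > 0`. [folklore] -/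
theorem pos_of_even_side (hq : ∀ i, M i = 2 * q i) (i : Fin 2) : 0 < q i := by
  have h := NeZero.ne (M i)
  rw [hq i] at h
  omega

omit [NeZero m] [∀ i, NeZero (k i)] [∀ i, NeZero (M i)] in
/-- With even cell sides: `k i · q i = m`. [folklore] -/
theorem k_mul_q_eq (hkM : ∀ i, k i * M i = m * 2) (hq : ∀ i, M i = 2 * q i) (i : Fin 2) : k i * q i = m := by
  have h := hkM i
  rw [hq i] at h
  linarith

/-- **The cell of a plaquette site**: `(cellIndex (2c + a))_i = c_i / q_i`. [folklore] -/
theorem val_cellIndex_cellSite (hkM : ∀ i, k i * M i = m * 2) (hq : ∀ i, M i = 2 * q i) (c : Fin 2 → Fin m)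
    (a : FermionTorus 2 2) (i : Fin 2) : (cellIndex hkM (cellSite c a) i).val = (c i : ℕ) / q i := by
  rw [val_cellIndex hkM, val_cellSite, hq i]
  have ha : (ofLex a i : ℕ) < 2 := Fin.isLt _
  have hqi := pos_of_even_side hq i
  obtain ⟨r, X, hr, hc⟩ : ∃ r X : ℕ, r < q i ∧ (c i : ℕ) = r + q i * X :=
    ⟨(c i : ℕ) % q i, (c i : ℕ) / q i, Nat.mod_lt _ hqi, (Nat.mod_add_div _ _).symm⟩
  rw [hc, show (ofLex a i : ℕ) + 2 * (r + q i * X) = ((ofLex a i : ℕ) + 2 * r) + (2 * q i) * X by ring,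
    Nat.add_mul_div_left _ _ (by omega), Nat.add_mul_div_left _ _ hqi,
    Nat.div_eq_of_lt (by omega : (ofLex a i : ℕ) + 2 * r < 2 * q i), Nat.div_eq_of_lt hr]

/-- **The position of a plaquette site in its cell**: `(cellPos (2c + a))_i = a_i + 2 (c_i mod q_i)`. [folklore] -/
theorem val_cellPos_cellSite (hkM : ∀ i, k i * M i = m * 2) (hq : ∀ i, M i = 2 * q i) (c : Fin 2 → Fin m)
    (a : FermionTorus 2 2) (i : Fin 2) : (cellPos hkM (cellSite c a) i).val = (ofLex a i : ℕ) + 2 * ((c i : ℕ) % q i) := by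
  rw [val_cellPos hkM, val_cellSite, hq i]
  have ha : (ofLex a i : ℕ) < 2 := Fin.isLt _
  have hqi := pos_of_even_side hq i
  obtain ⟨r, X, hr, hc⟩ : ∃ r X : ℕ, r < q i ∧ (c i : ℕ) = r + q i * X :=
    ⟨(c i : ℕ) % q i, (c i : ℕ) / q i, Nat.mod_lt _ hqi, (Nat.mod_add_div _ _).symm⟩
  rw [hc, show (ofLex a i : ℕ) + 2 * (r + q i * X) = ((ofLex a i : ℕ) + 2 * r) + (2 * q i) * X by ring,
    Nat.add_mul_mod_self_left, Nat.mod_eq_of_lt (by omega : (ofLex a i : ℕ) + 2 * r < 2 * q i),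
    Nat.add_mul_mod_self_left, Nat.mod_eq_of_lt hr]

/-- All sites of one plaquette lie in the same cell. [folklore] -/
theorem cellIndex_cellSite_eq (hkM : ∀ i, k i * M i = m * 2) (hq : ∀ i, M i = 2 * q i) (c : Fin 2 → Fin m)
    (a b : FermionTorus 2 2) : cellIndex hkM (cellSite c a) = cellIndex hkM (cellSite c b) := by
  funext i
  apply ZMod.val_injective
  rw [val_cellIndex_cellSite hkM hq, val_cellIndex_cellSite hkM hq]

/-- The in-cell position of a plaquette site as an element of `ℤ/M_i`. [folklore] -/
theorem cellPos_cellSite (hkM : ∀ i, k i * M i = m * 2) (hq : ∀ i, M i = 2 * q i) (c : Fin 2 → Fin m) (a : FermionTorus 2 2) :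
    cellPos hkM (cellSite c a) = fun i => (((ofLex a i : ℕ) + 2 * ((c i : ℕ) % q i) : ℕ) : ZMod (M i)) := by
  funext i
  have hlt : (ofLex a i : ℕ) + 2 * ((c i : ℕ) % q i) < M i := by
    have ha : (ofLex a i : ℕ) < 2 := Fin.isLt _
    have := Nat.mod_lt (c i : ℕ) (pos_of_even_side hq i)
    rw [hq i]; omega
  apply ZMod.val_injective
  rw [val_cellPos_cellSite hkM hq, ZMod.val_natCast, Nat.mod_eq_of_lt hlt]

omit [∀ i, NeZero (k i)] [∀ i, NeZero (M i)] in
/-- The coordinates of the neighbouring plaquette `c + e_j`. [folklore] -/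
theorem val_shiftCell (hm : 2 ≤ m) (c : Fin 2 → Fin m) (j i : Fin 2) :
    ((shiftCell c j i : Fin m) : ℕ) = if i = j then ((c j : ℕ) + 1) % m else (c i : ℕ) := by
  unfold shiftCell
  rw [Pi.add_apply]
  by_cases hij : i = j
  · subst hij
    rw [Pi.single_eq_same, if_pos rfl, Fin.val_add, Fin.val_one', Nat.mod_eq_of_lt (by omega : 1 < m)]
  · rw [Pi.single_eq_of_ne hij, add_zero, if_neg hij]

omit [∀ i, NeZero (k i)] [∀ i, NeZero (M i)] in
/-- The offset of the neighbouring plaquette: `(c + e_j)_j mod q_j = (c_j + 1) mod q_j`, other offsets unchanged. [folklore] -/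
theorem mod_shiftCell (hkM : ∀ i, k i * M i = m * 2) (hq : ∀ i, M i = 2 * q i) (hm : 2 ≤ m) (c : Fin 2 → Fin m) (j i : Fin 2) :
    ((shiftCell c j i : Fin m) : ℕ) % q i = if i = j then ((c j : ℕ) + 1) % q j else (c i : ℕ) % q i := by
  rw [val_shiftCell hm]
  by_cases hij : i = j
  · subst hij
    rw [if_pos rfl, if_pos rfl, Nat.mod_mod_of_dvd _ ⟨k i, by rw [mul_comm]; exact (k_mul_q_eq hkM hq i).symm⟩]
  · rw [if_neg hij, if_neg hij]

/-- **The cell of the neighbouring plaquette**: `cellIndex` of the sites of `c + e_j` is that of the sites of `c` when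
`c_j mod q_j + 1 < q_j` (same cell) and `+ e_j` otherwise (the next cell; on the torus of cells). [folklore] -/
theorem cellIndex_cellSite_shiftCell (hkM : ∀ i, k i * M i = m * 2) (hq : ∀ i, M i = 2 * q i) (hm : 2 ≤ m) (c : Fin 2 → Fin m)
    (j : Fin 2) (a b : FermionTorus 2 2) :
    cellIndex hkM (cellSite (shiftCell c j) b) =
      cellIndex hkM (cellSite c a) + (if (c j : ℕ) % q j + 1 < q j then 0 else Pi.single j 1) := by
  have hqj := pos_of_even_side hq j
  have hkq := k_mul_q_eq hkM hq j
  funext i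
  rw [Pi.add_apply]
  by_cases hij : i = j
  · subst hij
    obtain ⟨r, X, hr, hc⟩ : ∃ r X : ℕ, r < q i ∧ (c i : ℕ) = r + q i * X :=
      ⟨(c i : ℕ) % q i, (c i : ℕ) / q i, Nat.mod_lt _ hqj, (Nat.mod_add_div _ _).symm⟩
    have hX : X < k i := by
      have hlt : (c i : ℕ) < m := Fin.isLt _
      rw [hc, ← hkq] at hlt
      nlinarith
    have hmod : (c i : ℕ) % q i = r := by rw [hc, Nat.add_mul_mod_self_left, Nat.mod_eq_of_lt hr]
    have hnew : cellIndex hkM (cellSite (shiftCell c i) b) i = ((((c i : ℕ) + 1) % m / q i : ℕ) : ZMod (k i)) := by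
      apply ZMod.val_injective
      have hlt : ((c i : ℕ) + 1) % m < q i * k i := by
        rw [mul_comm, hkq]; exact Nat.mod_lt _ (by omega)
      rw [val_cellIndex_cellSite hkM hq, val_shiftCell hm, if_pos rfl, ZMod.val_natCast,
        Nat.mod_eq_of_lt (Nat.div_lt_of_lt_mul hlt)]
    have hold : cellIndex hkM (cellSite c a) i = ((X : ℕ) : ZMod (k i)) := by
      apply ZMod.val_injective
      rw [val_cellIndex_cellSite hkM hq, ZMod.val_natCast, Nat.mod_eq_of_lt hX, hc, Nat.add_mul_div_left _ _ hqj,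
        Nat.div_eq_of_lt hr, zero_add]
    rw [hnew, hold, hmod]
    split_ifs with hface
    · -- same cell
      rw [Pi.zero_apply, add_zero]
      have h1 : (c i : ℕ) + 1 < m := by rw [hc, ← hkq]; nlinarith
      rw [Nat.mod_eq_of_lt h1, hc, show r + q i * X + 1 = (r + 1) + q i * X by ring, Nat.add_mul_div_left _ _ hqj,
        Nat.div_eq_of_lt hface, zero_add]
    · -- across the face: `r = q - 1`
      have hr1 : r + 1 = q i := by omega
      rw [Pi.single_eq_same]
      have hc1 : (c i : ℕ) + 1 = q i * (X + 1) := by rw [hc]; nlinarith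
      by_cases hlast : X + 1 < k i
      · have h1 : (c i : ℕ) + 1 < m := by
          rw [hc1, ← hkq, mul_comm (k i)]; exact Nat.mul_lt_mul_of_pos_left hlast hqj
        rw [Nat.mod_eq_of_lt h1, hc1, Nat.mul_div_cancel_left _ hqj]
        push_cast; ring
      · have hX1 : X + 1 = k i := by omega
        have h1 : (c i : ℕ) + 1 = m := by rw [hc1, hX1, mul_comm, hkq]
        rw [h1, Nat.mod_self, Nat.zero_div, Nat.cast_zero, ← Nat.cast_one, ← Nat.cast_add, hX1, ZMod.natCast_self]
  · rw [show (if (c j : ℕ) % q j + 1 < q j then (0 : RectTorusSite k) else Pi.single j 1) i = 0 by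
      split_ifs <;> simp [Pi.single_eq_of_ne hij], add_zero]
    apply ZMod.val_injective
    rw [val_cellIndex_cellSite hkM hq, val_cellIndex_cellSite hkM hq, val_shiftCell hm, if_neg hij]

end CellArith

/-! ### §2. Sums over plaquettes of offset-periodic functions -/

section Counting

variable {m : ℕ} {k M : Fin 2 → ℕ} {q : Fin 2 → ℕ}

/-- **Plaquette indices = (cell, offset)**: `c_i = r_i + q_i X_i` identifies `(ℤ/m)²`-plaquette indices with pairs (cell index
`X_i < k_i`, offset `r_i < q_i`) when `k_i q_i = m`; hence a function of the plaquette index that depends only on the offset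
`c mod q` sums to `|k| ·` its sum over the offsets. [folklore] -/
theorem sum_plaquette_eq_card_mul_sum_offset [NeZero m] [∀ i, NeZero (k i)] (hkq : ∀ i, k i * q i = m) {β : Type*}
    [AddCommMonoid β] (Φ : (Fin 2 → ℕ) → β) :
    ∑ c : Fin 2 → Fin m, Φ (fun i => (c i : ℕ) % q i) =
      Fintype.card (RectTorusSite k) • ∑ r : (i : Fin 2) → Fin (q i), Φ (fun i => (r i : ℕ)) := by
  classical
  have hq : ∀ i, 0 < q i := fun i => Nat.pos_of_ne_zero fun h => by
    have := hkq i
    rw [h, mul_zero] at this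
    exact NeZero.ne m this.symm
  -- the bijection `c ↦ (c / q, c mod q)`
  let e : (Fin 2 → Fin m) ≃ ((i : Fin 2) → Fin (k i)) × ((i : Fin 2) → Fin (q i)) :=
    { toFun := fun c => (fun i => ⟨(c i : ℕ) / q i, Nat.div_lt_of_lt_mul (by rw [mul_comm, hkq]; exact Fin.isLt _)⟩,
        fun i => ⟨(c i : ℕ) % q i, Nat.mod_lt _ (hq i)⟩)
      invFun := fun p i => ⟨(p.2 i : ℕ) + q i * (p.1 i : ℕ), by
        have h1 := Fin.isLt (p.2 i); have h2 := Fin.isLt (p.1 i); rw [← hkq i]; nlinarith⟩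
      left_inv := fun c => by
        funext i
        exact Fin.ext (Nat.mod_add_div _ _)
      right_inv := fun p => by
        refine Prod.ext (funext fun i => Fin.ext ?_) (funext fun i => Fin.ext ?_)
        · show ((p.2 i : ℕ) + q i * (p.1 i : ℕ)) / q i = (p.1 i : ℕ)
          rw [Nat.add_mul_div_left _ _ (hq i), Nat.div_eq_of_lt (Fin.isLt _), zero_add]
        · show ((p.2 i : ℕ) + q i * (p.1 i : ℕ)) % q i = (p.2 i : ℕ)
          rw [Nat.add_mul_mod_self_left, Nat.mod_eq_of_lt (Fin.isLt _)] }
  rw [Fintype.sum_equiv e (fun c => Φ (fun i => (c i : ℕ) % q i)) (fun p => Φ (fun i => (p.2 i : ℕ))) (fun c => rfl),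
    Fintype.sum_prod_type]
  dsimp only
  rw [Finset.sum_const, Finset.card_univ]
  congr 1
  rw [card_rectTorusSite_eq_prod, Fintype.card_pi]
  exact Finset.prod_congr rfl fun i _ => Fintype.card_fin _

end Counting

/-! ### §3. Bloch entries between plaquette sites -/

section Entries

variable {m : ℕ} [NeZero m] {k M : Fin 2 → ℕ} [∀ i, NeZero (k i)] [∀ i, NeZero (M i)] {q : Fin 2 → ℕ}

/-- **Entries inside one plaquette are entries of the zeroth harmonic** `|k|⁻¹ Σ_κ G κ` at the positions `a + 2 (c mod q)`.
[cite: BachLiebSolovej1994, eq. (3a.2)] -/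
theorem blochMatrix_cellSite_same (hkM : ∀ i, k i * M i = m * 2) (hq : ∀ i, M i = 2 * q i)
    (G : RectTorusSite k → Matrix (RectTorusSite M) (RectTorusSite M) ℂ) (c : Fin 2 → Fin m) (a a' : FermionTorus 2 2) :
    blochMatrix hkM G (cellSite c a) (cellSite c a') = ((Fintype.card (RectTorusSite k) : ℂ))⁻¹ *
      ∑ κ, G κ (fun i => (((ofLex a i : ℕ) + 2 * ((c i : ℕ) % q i) : ℕ) : ZMod (M i)))
        (fun i => (((ofLex a' i : ℕ) + 2 * ((c i : ℕ) % q i) : ℕ) : ZMod (M i))) := by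
  rw [blochMatrix_apply, cellIndex_cellSite_eq hkM hq c a a', sub_self, cellPos_cellSite hkM hq, cellPos_cellSite hkM hq]
  simp only [blockChar_zero_right, one_mul]

/-- **Entries between the two plaquettes of a link window.** For the link `(c, c + e_j)` write `b, b' ∈ {0,1}` for the plaquette
of the two sites; the cell-index difference is `(β(b) - β(b')) e_j` with `β(b) = [b = 1 ∧ the link crosses a cell face]`
(face: `c_j mod q_j + 1 = q_j`), and the positions are `a + 2 r`, `r` the offset of the respective plaquette. [cite: BachLiebSolovej1994, eq. (3a.2)] -/
theorem blochMatrix_linkSite (hkM : ∀ i, k i * M i = m * 2) (hq : ∀ i, M i = 2 * q i) (hm : 2 ≤ m)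
    (G : RectTorusSite k → Matrix (RectTorusSite M) (RectTorusSite M) ℂ) (c : Fin 2 → Fin m) (j : Fin 2)
    (p p' : Fin 2 ×ₗ FermionTorus 2 2) :
    blochMatrix hkM G (linkEmb hm c j p) (linkEmb hm c j p') = ((Fintype.card (RectTorusSite k) : ℂ))⁻¹ *
      ∑ κ, blockChar κ
          ((if (ofLex p).1 = 0 then (0 : RectTorusSite k) else if (c j : ℕ) % q j + 1 < q j then 0 else Pi.single j 1) -
            (if (ofLex p').1 = 0 then (0 : RectTorusSite k) else if (c j : ℕ) % q j + 1 < q j then 0 else Pi.single j 1)) *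
        G κ (fun i => (((ofLex (ofLex p).2 i : ℕ) + 2 * (if (ofLex p).1 = 0 then (c i : ℕ) % q i else
              if i = j then ((c j : ℕ) + 1) % q j else (c i : ℕ) % q i) : ℕ) : ZMod (M i)))
          (fun i => (((ofLex (ofLex p').2 i : ℕ) + 2 * (if (ofLex p').1 = 0 then (c i : ℕ) % q i else
              if i = j then ((c j : ℕ) + 1) % q j else (c i : ℕ) % q i) : ℕ) : ZMod (M i))) := by
  -- the cell index and the position of a site of the window, by plaquette
  have hidx : ∀ pp : Fin 2 ×ₗ FermionTorus 2 2, cellIndex hkM (linkEmb hm c j pp) = cellIndex hkM (cellSite c (ofLex pp).2) +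
      (if (ofLex pp).1 = 0 then (0 : RectTorusSite k) else if (c j : ℕ) % q j + 1 < q j then 0 else Pi.single j 1) := by
    intro pp
    rw [linkEmb_apply]
    split_ifs with h0 hface
    · rw [add_zero]
    · rw [cellIndex_cellSite_shiftCell hkM hq hm c j (ofLex pp).2 (ofLex pp).2, if_pos hface]
    · rw [cellIndex_cellSite_shiftCell hkM hq hm c j (ofLex pp).2 (ofLex pp).2, if_neg hface]
  have hpos : ∀ pp : Fin 2 ×ₗ FermionTorus 2 2, cellPos hkM (linkEmb hm c j pp) =
      fun i => (((ofLex (ofLex pp).2 i : ℕ) + 2 * (if (ofLex pp).1 = 0 then (c i : ℕ) % q i else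
        if i = j then ((c j : ℕ) + 1) % q j else (c i : ℕ) % q i) : ℕ) : ZMod (M i)) := by
    intro pp
    rw [linkEmb_apply]
    split_ifs with h0
    · exact cellPos_cellSite hkM hq c _
    · rw [cellPos_cellSite hkM hq]
      funext i
      rw [mod_shiftCell hkM hq hm]
  rw [blochMatrix_apply, hidx p, hidx p', hpos p, hpos p', cellIndex_cellSite_eq hkM hq c (ofLex p).2 (ofLex p').2]
  congr 1
  refine Finset.sum_congr rfl fun κ _ => ?_
  congr 2
  abel

end Entries

end Summit.Ventures.CertifiedManyBodySolver.Upper
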